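import Literature.AnabelianGeometry.EtaleTheta.Discharge.Sec4Prop42iiiThetaTwistTowerSmallIndex

/-!
# [EtTh] Prop. 4.2 (iii) at the small-index fourth model, RE-ANCHORED: `N`-th roots over ANY Frobenius-trivial Galois-based object — the input
# of the nested root datum `R : NthRoot Rl.root Rl.pair N` of the §5 junction (Def. 4.1 (iii)(iv) p.313, Prop. 4.2 (iii) p.314, Rmk. 4.3.2 p.318 / PDF pp.87–88, 92)

S. Mochizuki, *The étale theta function …*, Publ. RIMS **45** (2009) [MochizukiEtTh2009], Def. 4.1 (iii)(iv) p.313 (PDF p.87), Prop. 4.2 (iii) p.314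
(PDF p.88), Rmk. 4.3.2 p.318 (PDF p.92) («compatible choices» of roots along `A_{lN} → A_l → A_⊙`).  [cite: MochizukiEtTh2009, Prop 4.2 (iii) p.314 (PDF p.88)]
PAGE CONVENTION for [EtTh]: «printed N (PDF p.M)», N = M + 226.

abc-iut cell, layer L2, seat abc-iut-L2-t3 (gen 10), corollary keyed by abc-iut-L2-lead R1363 («the one-line re-anchored root … is yours to land either
way, input for whoever holds the transport N-P42III-DOMAIN@SMALL-INDEX»).  PROOF-ONLY; ADDITIVE; BY NAME from `prop42_iii_mkOfQuotientTemperoid_small`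
(p512762).  WHAT IT IS / IS NOT (the nested-inhabitation answer of record, R1363 (iii)): `Prop42_iii` quantifies fraction pairs of units on the ANCHOR
only; since the small-index theorem holds for EVERY Frobenius-trivial Galois-based anchor, RE-ANCHORING the §4 setting at the `l`-domain `A_l := Rl.AN`
of an `l`-th root datum yields `N`-th roots of `Rl.root` IN THE RE-ANCHORED SETTING — this file.  It is NOT yet the nested binder of
`ThetaFrobenioid.ofQuotientTemperoidData`, whose `NthRoot Rl.root Rl.pair N` lives in the `A_⊙`-anchored setting (its `IsSaturated` is relative to
`H_⊙(A_⊙)`: `isAmple`, `IsFixedByHA`, `HodotBsFld`); the identification = print's Rmk. 4.3.2 compatible choice = VNEXT «N-P42III-DOMAIN@SMALL-INDEX»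
(holder per R1363).  HONEST FRAMING: class-(b) design carrier; onto-socket design-only; trivial `(N,H)`-slot; nothing here bears on [IUTchIII]
Cor. 3.12 or asserts abc proved/refuted; typed ≠ proved.
-/

noncomputable section

namespace Literature.AnabelianGeometry.EtaleTheta

open CategoryTheory Opposite Function Literature.AlgebraicGeometry.Frobenioids Literature.AnabelianGeometry.SemiGraphs
  Literature.AnabelianGeometry.SemiGraphs.GaloisObjects LogDivisorModel LogDivisorTower TateTowerKummerTwistRShear
  LogDivisorModel.TateTowerThetaTwist

namespace ThetaTwistTowerSmallIndex

variable (R S : ((ConnectedPart (BTemp (Compat 3 thetaShear)))ᵒᵖ ⥤ CommMonCat.{0}) → Prop)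
  {K : Type} [Field K] (X : TemperedArithmeticGroup.{0} K) (φ : X.Pi →ₜ* Compat 3 thetaShear) (hφ : Function.Surjective φ)

/-- **`N`-th roots over ANY Frobenius-trivial Galois-based object `A₁` of the small-index fourth model** (the §4 setting re-anchored at `A₁`,
trivial `(N,H)`-slot): every fraction pair of every birational unit on `A₁` has an `N`-th root object, for every `N ≥ 1`.
[cite: MochizukiEtTh2009, Prop 4.2 (iii) p.314 (PDF p.88)] -/
theorem nonempty_nthRoot_reanchored_small (A₁ : (temperedFrobenioidSmall R S).category)
    (hA₁ : PreFrobenioid.IsFrobeniusTrivial (temperedFrobenioidSmall R S).toElem A₁) (hA₁' : IsGaloisObj A₁.base.obj) (N : ℕ+)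
    (f : (BiKummerSetting.mkOfQuotientTemperoid X isTempered_compat₃' φ hφ (temperedFrobenioidSmall R S) rfl (hPSmall R S)
      (fun _ _ _ => True) A₁ hA₁ hA₁').biratUnits A₁)
    {B : (BiKummerSetting.mkOfQuotientTemperoid X isTempered_compat₃' φ hφ (temperedFrobenioidSmall R S) rfl (hPSmall R S)
      (fun _ _ _ => True) A₁ hA₁ hA₁').C}
    (P : (BiKummerSetting.mkOfQuotientTemperoid X isTempered_compat₃' φ hφ (temperedFrobenioidSmall R S) rfl (hPSmall R S)
      (fun _ _ _ => True) A₁ hA₁ hA₁').FractionPair f B) :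
    Nonempty ((BiKummerSetting.mkOfQuotientTemperoid X isTempered_compat₃' φ hφ (temperedFrobenioidSmall R S) rfl (hPSmall R S)
      (fun _ _ _ => True) A₁ hA₁ hA₁').NthRoot f P N (fun ψ x => (temperedFrobenioidSmall R S).pullFracModel ψ x)) :=
  prop42_iii_mkOfQuotientTemperoid_small R S X φ hφ A₁ hA₁ hA₁' f P N

set_option maxHeartbeats 1600000 in
/-- **The re-anchored root of an `l`-th root datum of the `Ÿ`-anchored setting**: for `Rl : NthRoot θ Pl l` in `settingSmallYdd` whose `l`-domain
`A_l := Rl.AN` is Frobenius-trivial with Galois base (as it is for the roots produced by Prop. 4.2 (iii): pull-backs over deep Galois coverings),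
EVERY fraction pair `P′` of `Rl.root` in the setting RE-ANCHORED at `A_l` has an `N`-th root object — the input datum of the transport
«N-P42III-DOMAIN@SMALL-INDEX» (Rmk. 4.3.2).  (Elaboration: reading `Rl.root`, a unit of the `Ÿ`-anchored setting, as a unit of the re-anchored
setting unfolds both settings to the canonical model — raised heartbeat budget.) [cite: MochizukiEtTh2009, Rmk 4.3.2 p.318 (PDF p.92)] -/
theorem nonempty_nthRoot_reanchored_of_lthRoot_settingSmallYdd {Nθ : ℕ+} (T : ThetaEnvData.{0} Nθ) (ιX : T.PiX ≃ₜ* X.Pi)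
    {θ : (settingSmallYdd R S X φ hφ (fun _ _ _ => True) T ιX).biratUnits (settingSmallYdd R S X φ hφ (fun _ _ _ => True) T ιX).Aodot}
    {Bl : (settingSmallYdd R S X φ hφ (fun _ _ _ => True) T ιX).C}
    {Pl : (settingSmallYdd R S X φ hφ (fun _ _ _ => True) T ιX).FractionPair θ Bl} {lv : ℕ+}
    (Rl : (settingSmallYdd R S X φ hφ (fun _ _ _ => True) T ιX).NthRoot θ Pl lv
      (fun ψ x => (temperedFrobenioidSmall R S).pullFracModel ψ x))
    (hA : PreFrobenioid.IsFrobeniusTrivial (temperedFrobenioidSmall R S).toElem Rl.AN) (hA' : IsGaloisObj Rl.AN.base.obj) (N : ℕ+)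
    {B' : (BiKummerSetting.mkOfQuotientTemperoid X isTempered_compat₃' φ hφ (temperedFrobenioidSmall R S) rfl (hPSmall R S)
      (fun _ _ _ => True) Rl.AN hA hA').C}
    (P' : (BiKummerSetting.mkOfQuotientTemperoid X isTempered_compat₃' φ hφ (temperedFrobenioidSmall R S) rfl (hPSmall R S)
      (fun _ _ _ => True) Rl.AN hA hA').FractionPair Rl.root B') :
    Nonempty ((BiKummerSetting.mkOfQuotientTemperoid X isTempered_compat₃' φ hφ (temperedFrobenioidSmall R S) rfl (hPSmall R S)
      (fun _ _ _ => True) Rl.AN hA hA').NthRoot Rl.root P' N (fun ψ x => (temperedFrobenioidSmall R S).pullFracModel ψ x)) :=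
  nonempty_nthRoot_reanchored_small R S X φ hφ Rl.AN hA hA' N Rl.root P'

end ThetaTwistTowerSmallIndex

end Literature.AnabelianGeometry.EtaleTheta

end
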